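import Literature.Probability.LatticeModels.PairPotentialHighTemperatureLSI
import HarnessLib

/-!
# The nearest-neighbour Ising model on `ℤ^d`: the finite-range-potential presentation IS the Friedli–Velenik
# specification; hence a uniform log-Sobolev inequality, strong mixing and uniqueness for `isingSpecification`
# at `4dβ < 1` — PROVED

Topic `Literature/Probability/LatticeModels`; cell `ym-ir`, seat lit-3 (rows B2/B4/B17).  THEOREMS ONLY (D-0026).
The tree carries two formalisations of the Ising model on `ℤ^d`: the graph-based finite-volume Gibbs measures
`isingMeasure (zdGraph d) Λ β h (.fixed η)` / `isingSpecification (zdGraph d) β h` of `IsingModel.lean`,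
`GibbsSpecification.lean` (Friedli–Velenik 2017 §3.1, §6.2: `H = −Σ_{e∈ℰ_Λ^b} σ_e − h Σ_{x∈Λ} σ_x`, reference
measure `count ∘ glue⁻¹`), and the Martinelli finite-range potentials `FRPotential.spec` of
`StrongMixingFiniteSize.lean` / `PairPotentialHighTemperatureLSI.lean` (`gibbsSpecOfPotential count U (interactionSets r) β`).
This file proves they AGREE for the nearest-neighbour pair potential `FRPotential.nnIsing d 1 h`
(`nnIsing_spec_eq_isingSpecification`), so every result of the Glauber/strong-mixing library applies to the
Friedli–Velenik Ising specification; in particular [BB19] Theorem 1 (through `FRPotential.nnIsing_logSobolevIneq`)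
and [Mar99] Theorem 3.3 give, for `0 < β` with `4dβ < 1` and every field `h`:
`isingSpecification_logSobolevIneq` (log-Sobolev constant `≤ (1 + 2β′/(1−β′))/2`, `β′ = 4dβ`, uniformly in the
volume and the boundary condition), `isingSpecification_SMT_unique` (`SMT(B_L, l₀, α)` on all cubes and
`HasUniqueGibbsMeasure (isingSpecification (zdGraph d) β h)`).
SIBLING-SETTING results; nothing here bears on lattice gauge theory or the Yang–Mills gap.

Sources: [BB19] R. Bauerschmidt, T. Bodineau, J. Funct. Anal. 276 (2019), Theorem 1 (`paper:arxiv-1712.03676`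
p0003 L44–69). [cite: BauerschmidtBodineau2019, Theorem 1]  [Mar99] F. Martinelli, LNM 1717 (1999), Def 2.1
(the Ising model as a finite-range potential), Theorem 3.3. [cite: Martinelli1999, Theorem 3.3]
[FV17] S. Friedli, Y. Velenik, *Statistical Mechanics of Lattice Systems* (2017), §3.1 (3.2)/(3.6), §6.2 (6.6).
[cite: FriedliVelenik2017, §3.1]

## Contents (all proved)

* `zdGraph_adj_zero_sub_iff` (`0 ∼ y − x ↔ x ∼ y`), `FRPotential.pairJ_nnCoupling` (`J̃_{xy} = J_c·[x ∼ y]`).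
* `sum_edgesTouching_eq_half_sum` — double counting: for symmetric `f`,
  `Σ_{e ∈ ℰ_Λ^b} f(e) = ½ Σ_{x,y ∈ N_1(Λ)} [x ∼ y][{x,y} ∩ Λ ≠ ∅] f(x,y)`.
* `FRPotential.hamiltonianIn_nnIsing` — `H_Λ^{nnIsing}(σ) = −J_c Σ_{e∈ℰ_Λ^b} σ_e − h₀ Σ_{x∈Λ} σ_x` for EVERY `σ`
  (`= isingHamiltonian (zdGraph d) Λ h₀ (.fixed η) σ` when `J_c = 1`).
* `pi_count_eq_count` — `count^{⊗Λ} = count` on `{±1}^Λ`.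
* **`FRPotential.nnIsing_spec_eq_isingSpecification`** — `(nnIsing d 1 h).spec β = isingSpecification (zdGraph d) β h`.
* **`isingSpecification_logSobolevIneq`**, **`isingSpecification_poincareIneq`**, **`isingSpecification_SMT_unique`**
  (`0 < d`, `0 < β`, `4dβ < 1`, any `h`).
-/

noncomputable section

open MeasureTheory ProbabilityTheory Finset

namespace Literature.Probability.LatticeModels

variable {d : ℕ}

/-! ### Nearest-neighbour adjacency and the symmetrised coupling -/

/-- Adjacency in `ℤ^d` is translation invariant: `0 ∼ y − x ↔ x ∼ y`. [cite: FriedliVelenik2017, §3.1] -/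
theorem zdGraph_adj_zero_sub_iff (x y : Site d) : (zdGraph d).Adj 0 (y - x) ↔ (zdGraph d).Adj x y := by
  rw [zdGraph_adj_iff, zdGraph_adj_iff]
  constructor
  · rintro ⟨i, h | h⟩
    · refine ⟨i, Or.inl ?_⟩
      funext j
      have := congrFun h j
      simp only [Pi.sub_apply, Pi.add_apply, Pi.zero_apply] at this ⊢
      linarith
    · refine ⟨i, Or.inr ?_⟩
      funext j
      have := congrFun h j
      simp only [Pi.sub_apply, Pi.add_apply, Pi.zero_apply] at this ⊢
      linarith
  · rintro ⟨i, h | h⟩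
    · refine ⟨i, Or.inl ?_⟩
      funext j
      have := congrFun h j
      simp only [Pi.sub_apply, Pi.add_apply, Pi.zero_apply] at this ⊢
      linarith
    · refine ⟨i, Or.inr ?_⟩
      funext j
      have := congrFun h j
      simp only [Pi.sub_apply, Pi.add_apply, Pi.zero_apply] at this ⊢
      linarith

namespace FRPotential

/-- The symmetrised nearest-neighbour coupling is `J_c` on edges of `ℤ^d` and `0` otherwise.
[cite: Martinelli1999, §2.1 (the Ising model)] -/
theorem pairJ_nnCoupling (Jc : ℝ) (x y : Site d) :
    pairJ (nnCoupling d Jc) x y = if (zdGraph d).Adj x y then Jc else 0 := by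
  unfold pairJ nnCoupling
  by_cases hxy : x = y
  · subst hxy
    rw [if_pos rfl, if_neg (SimpleGraph.irrefl _)]
  · rw [if_neg hxy]
    have e1 : (zdGraph d).Adj 0 (y - x) ↔ (zdGraph d).Adj x y := zdGraph_adj_zero_sub_iff x y
    have e2 : (zdGraph d).Adj 0 (x - y) ↔ (zdGraph d).Adj x y :=
      (zdGraph_adj_zero_sub_iff y x).trans ⟨fun h => h.symm, fun h => h.symm⟩
    by_cases h : (zdGraph d).Adj x y
    · rw [if_pos (e1.2 h), if_pos (e2.2 h), if_pos h]; ring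
    · rw [if_neg (fun h' => h (e1.1 h')), if_neg (fun h' => h (e2.1 h')), if_neg h]; ring

end FRPotential

/-! ### Double counting: edges touching `Λ` versus ordered adjacent pairs -/

/-- **Edges touching `Λ` as ordered pairs**: for a symmetric `f`, `Σ_{e ∈ ℰ_Λ^b} f(e) = ½ Σ_{x,y ∈ N_1(Λ)} [x ∼ y]
[{x,y} ∩ Λ ≠ ∅] f(x,y)` (each edge `{a,b}` touching `Λ` is hit by exactly the two ordered pairs `(a,b)`, `(b,a)`,
both inside the `1`-neighbourhood of `Λ`). [cite: FriedliVelenik2017, §3.1 (the edge set ℰ_Λ^b)] -/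
theorem sum_edgesTouching_eq_half_sum (Λ : Finset (Site d)) (f : Site d → Site d → ℝ)
    (hf : ∀ a b, f a b = f b a) :
    ∑ e ∈ edgesTouching (zdGraph d) Λ, Sym2.lift ⟨f, hf⟩ e =
      (1 / 2) * ∑ x ∈ FRPotential.nbhd 1 Λ, ∑ y ∈ FRPotential.nbhd 1 Λ,
        (if (zdGraph d).Adj x y ∧ (({x, y} : Finset (Site d)) ∩ Λ).Nonempty then f x y else 0) := by
  classical
  set N := FRPotential.nbhd 1 Λ with hN
  set E := edgesTouching (zdGraph d) Λ with hE
  set P := (N ×ˢ N).filter (fun p => (zdGraph d).Adj p.1 p.2 ∧ (({p.1, p.2} : Finset (Site d)) ∩ Λ).Nonempty)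
    with hP
  -- membership facts
  have hmemE : ∀ a b : Site d, s(a, b) ∈ E ↔ (zdGraph d).Adj a b ∧ (a ∈ Λ ∨ b ∈ Λ) := by
    intro a b
    rw [hE, edgesTouching, mem_biUnion]
    constructor
    · rintro ⟨v, hv, he⟩
      rw [SimpleGraph.mem_incidenceFinset, SimpleGraph.mk'_mem_incidenceSet_iff] at he
      rcases he.2 with rfl | rfl
      · exact ⟨he.1, Or.inl hv⟩
      · exact ⟨he.1, Or.inr hv⟩
    · rintro ⟨hab, ha | hb⟩
      · exact ⟨a, ha, by rw [SimpleGraph.mem_incidenceFinset, SimpleGraph.mk'_mem_incidenceSet_iff]; exact ⟨hab, Or.inl rfl⟩⟩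
      · exact ⟨b, hb, by rw [SimpleGraph.mem_incidenceFinset, SimpleGraph.mk'_mem_incidenceSet_iff]; exact ⟨hab, Or.inr rfl⟩⟩
  have hnbr : ∀ a b : Site d, (zdGraph d).Adj a b → a ∈ Λ → b ∈ N := by
    intro a b hab ha
    rw [hN, FRPotential.nbhd, mem_biUnion]
    refine ⟨a, ha, mem_rNeighbourhood.2 ?_⟩
    rw [supDist_comm]
    exact (zdStar_adj.1 (zdGraph_le_zdStar hab)).2
  have hΛN : Λ ⊆ N := FRPotential.subset_nbhd 1 Λ
  have htouch : ∀ a b : Site d, (({a, b} : Finset (Site d)) ∩ Λ).Nonempty ↔ a ∈ Λ ∨ b ∈ Λ := by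
    intro a b
    constructor
    · rintro ⟨z, hz⟩
      rw [mem_inter, mem_insert, Finset.mem_singleton] at hz
      rcases hz.1 with rfl | rfl
      · exact Or.inl hz.2
      · exact Or.inr hz.2
    · rintro (ha | hb)
      · exact ⟨a, mem_inter.2 ⟨mem_insert_self a {b}, ha⟩⟩
      · exact ⟨b, mem_inter.2 ⟨mem_insert_of_mem (mem_singleton_self b), hb⟩⟩
  have hmemP : ∀ a b : Site d, (a, b) ∈ P ↔ (zdGraph d).Adj a b ∧ (a ∈ Λ ∨ b ∈ Λ) := by
    intro a b
    rw [hP, mem_filter, mem_product, htouch]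
    constructor
    · rintro ⟨_, hab, h⟩; exact ⟨hab, h⟩
    · rintro ⟨hab, h⟩
      refine ⟨⟨?_, ?_⟩, hab, h⟩
      · rcases h with ha | hb
        · exact hΛN ha
        · exact hnbr b a hab.symm hb
      · rcases h with ha | hb
        · exact hnbr a b hab ha
        · exact hΛN hb
  -- rewrite the double sum as a sum over `P`
  have hdouble : ∑ x ∈ N, ∑ y ∈ N,
      (if (zdGraph d).Adj x y ∧ (({x, y} : Finset (Site d)) ∩ Λ).Nonempty then f x y else 0) =
      ∑ p ∈ P, f p.1 p.2 := by
    rw [hP, sum_filter, ← sum_product']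
  rw [hdouble]
  -- fibrewise over the edge map
  have hmaps : ∀ p ∈ P, s(p.1, p.2) ∈ E := by
    rintro ⟨a, b⟩ hp
    exact (hmemE a b).2 ((hmemP a b).1 hp)
  rw [← sum_fiberwise_of_maps_to hmaps, mul_sum]
  refine sum_congr rfl fun e he => ?_
  induction e using Sym2.ind with
  | _ a b =>
    have hab := ((hmemE a b).1 he)
    have hne : a ≠ b := hab.1.ne
    have hfib : P.filter (fun p => s(p.1, p.2) = s(a, b)) = {(a, b), (b, a)} := by
      ext ⟨x, y⟩
      rw [mem_filter, mem_insert, Finset.mem_singleton, Sym2.eq_iff, hmemP]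
      constructor
      · rintro ⟨_, ⟨rfl, rfl⟩ | ⟨rfl, rfl⟩⟩
        · exact Or.inl rfl
        · exact Or.inr rfl
      · rintro (h | h)
        · rw [Prod.mk.injEq] at h
          obtain ⟨rfl, rfl⟩ := h
          exact ⟨hab, Or.inl ⟨rfl, rfl⟩⟩
        · rw [Prod.mk.injEq] at h
          obtain ⟨rfl, rfl⟩ := h
          exact ⟨⟨hab.1.symm, hab.2.symm⟩, Or.inr ⟨rfl, rfl⟩⟩
    rw [hfib, sum_pair (fun h => hne (Prod.mk.injEq _ _ _ _ ▸ h).1), Sym2.lift_mk]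
    simp only
    rw [hf b a]
    ring

namespace FRPotential

/-- **The Hamiltonian of `nnIsing` is the Friedli–Velenik Hamiltonian with the edge set `ℰ_Λ^b`**:
`H_Λ(σ) = −J_c Σ_{e ∈ ℰ_Λ^b} σ_e − h₀ Σ_{x∈Λ} σ_x` for every configuration `σ`.
[cite: FriedliVelenik2017, §3.1 (3.2)/(3.6)] -/
theorem hamiltonianIn_nnIsing (Jc h₀ : ℝ) (Λ : Finset (Site d)) (σ : Site d → ℤˣ) :
    hamiltonianIn (nnIsing d Jc h₀).U (interactionSets 1) Λ σ =
      -(Jc * ∑ e ∈ edgesTouching (zdGraph d) Λ, bondSpin σ e) - h₀ * ∑ x ∈ Λ, spinAt x σ := by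
  classical
  have hU : (nnIsing d Jc h₀).U = pairU (nnCoupling d Jc) h₀ := rfl
  rw [hU, hamiltonianIn_pairU]
  set f : Site d → Site d → ℝ := fun x y => Jc * (spinAt x σ * spinAt y σ) with hf
  have hfs : ∀ a b, f a b = f b a := fun a b => by simp only [hf]; ring
  have hhalf := sum_edgesTouching_eq_half_sum Λ f hfs
  have hlift : ∀ e, Sym2.lift ⟨f, hfs⟩ e = Jc * bondSpin σ e := by
    intro e
    induction e using Sym2.ind with
    | _ a b => rw [Sym2.lift_mk, bondSpin_mk]
  simp_rw [hlift] at hhalf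
  rw [← mul_sum] at hhalf
  have hsum : ∑ x ∈ nbhd 1 Λ, ∑ y ∈ nbhd 1 Λ,
      (if (({x, y} : Finset (Site d)) ∩ Λ).Nonempty then pairJ (nnCoupling d Jc) x y * (spinAt x σ * spinAt y σ) else 0) =
      ∑ x ∈ nbhd 1 Λ, ∑ y ∈ nbhd 1 Λ,
        (if (zdGraph d).Adj x y ∧ (({x, y} : Finset (Site d)) ∩ Λ).Nonempty then f x y else 0) := by
    refine sum_congr rfl fun x _ => sum_congr rfl fun y _ => ?_
    rw [pairJ_nnCoupling]
    by_cases h2 : (({x, y} : Finset (Site d)) ∩ Λ).Nonempty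
    · by_cases h1 : (zdGraph d).Adj x y
      · rw [if_pos h2, if_pos h1, if_pos ⟨h1, h2⟩]
      · rw [if_pos h2, if_neg h1, if_neg (fun h => h1 h.1), zero_mul]
    · rw [if_neg h2, if_neg (fun h => h2 h.2)]
  rw [hsum, ← hhalf]
  ring

/-- The product of counting measures on the finite configuration space `{±1}^Λ` is the counting measure.
[cite: FriedliVelenik2017, §3.1 (Ω_Λ)] -/
theorem pi_count_eq_count (Λ : Finset (Site d)) :
    (Measure.pi fun _ : ↥Λ => (Measure.count : Measure ℤˣ)) = (Measure.count : Measure (↥Λ → ℤˣ)) := by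
  refine Measure.ext_of_singleton fun ζ => ?_
  rw [Measure.pi_singleton, Measure.count_singleton]
  simp

/-- **The two presentations of the nearest-neighbour Ising model on `ℤ^d` coincide**: the finite-volume Gibbs
distributions of the range-1 pair potential `nnIsing d 1 h` ([Mar99] Def 2.1) are the Friedli–Velenik finite-volume
Gibbs measures with fixed boundary condition ([FV17] (3.6)–(3.7), (6.6)):
`(nnIsing d 1 h).spec β Λ η = isingMeasure (zdGraph d) Λ β h (.fixed η)`. [cite: FriedliVelenik2017, §6.2 (6.6)] -/
theorem nnIsing_spec_eq_isingSpecification (β h : ℝ) :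
    (nnIsing d 1 h).spec β = isingSpecification (zdGraph d) β h := by
  classical
  funext Λ η
  rw [isingSpecification_apply]
  unfold FRPotential.spec gibbsSpecOfPotential isingMeasure isingRef
  rw [pi_count_eq_count]
  have href : (Measure.count : Measure (↥Λ → ℤˣ)).map (glueWith Λ · η) =
      (Measure.count : Measure (↥Λ → ℤˣ)).map (fun τ => glue Λ τ (.fixed η)) := by
    congr 1
  rw [href]
  congr 1
  funext σ
  rw [hamiltonianIn_nnIsing, isingHamiltonian, interactionEdges_fixed, one_mul]

end FRPotential

/-! ### Consequences for `isingSpecification (zdGraph d) β h` at `4dβ < 1` -/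

/-- **Uniform log-Sobolev inequality for the Friedli–Velenik Ising specification on `ℤ^d` at `4dβ < 1`** ([BB19]
Theorem 1): for every finite `Λ`, every boundary condition `η` and every field `h`,
`c_s(μ_{Λ;β,h}^η) ≤ (1 + 2β′/(1−β′))/2`, `β′ = 4dβ`. [cite: BauerschmidtBodineau2019, Theorem 1] -/
theorem isingSpecification_logSobolevIneq (hd : 0 < d) {β : ℝ} (hβ : 0 < β) (h4 : 4 * d * β < 1) (h : ℝ)
    (Λ : Finset (Site d)) (η : Site d → ℤˣ) :
    Glauber.LogSobolevIneq (isingSpecification (zdGraph d) β h Λ η) Λ ((1 + 2 * (4 * d * β) / (1 - 4 * d * β)) / 2) := by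
  rw [← FRPotential.nnIsing_spec_eq_isingSpecification]
  have h4' : 4 * (d : ℝ) * 1 * β < 1 := by simpa using h4
  have := FRPotential.nnIsing_logSobolevIneq d h hd one_pos hβ h4' Λ η
  simpa using this

/-- **Uniform spectral gap for the Ising heat-bath dynamics on `ℤ^d` at `4dβ < 1`**: `gap(L_Λ^η) ≥ c⁻¹` for all
finite `Λ` and all `η`. [cite: Martinelli1999, Theorem 3.3 (proof)] -/
theorem isingSpecification_poincareIneq (hd : 0 < d) {β : ℝ} (hβ : 0 < β) (h4 : 4 * d * β < 1) (h : ℝ)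
    (Λ : Finset (Site d)) (η : Site d → ℤˣ) :
    Glauber.PoincareIneq (isingSpecification (zdGraph d) β h Λ η) Λ ((1 + 2 * (4 * d * β) / (1 - 4 * d * β)) / 2)⁻¹ := by
  haveI : IsProbabilityMeasure (isingSpecification (zdGraph d) β h Λ η) := by
    rw [isingSpecification_apply]; infer_instance
  have h1 : 0 < 1 - 4 * d * β := by linarith
  have hc : 0 < (1 + 2 * (4 * d * β) / (1 - 4 * d * β)) / 2 := by positivity
  exact Glauber.LogSobolevIneq.poincareIneq hc (isingSpecification_logSobolevIneq hd hβ h4 h Λ η)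

/-- **Strong mixing and uniqueness for the Ising model on `ℤ^d` at `4dβ < 1`, any field** ([BB19] Theorem 1 +
[Mar99] Theorem 3.3 (b)–(c)): there are `α, l₀ > 0` with `SMT(B_L, l₀, α)` for all cubes, and
`isingSpecification (zdGraph d) β h` admits exactly one Gibbs measure. [cite: Martinelli1999, Theorem 3.3] -/
theorem isingSpecification_SMT_unique (hd : 0 < d) {β : ℝ} (hβ : 0 < β) (h4 : 4 * d * β < 1) (h : ℝ) :
    (∃ α l₀ : ℝ, 0 < α ∧ 0 < l₀ ∧ ∀ L : ℕ, SMT (isingSpecification (zdGraph d) β h) (centeredCube d L) l₀ α) ∧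
      HasUniqueGibbsMeasure (isingSpecification (zdGraph d) β h) := by
  rw [← FRPotential.nnIsing_spec_eq_isingSpecification]
  have h4' : 4 * (d : ℝ) * 1 * β < 1 := by simpa using h4
  exact FRPotential.nnIsing_SMT_unique d h hd one_pos hβ h4'

end Literature.Probability.LatticeModels

end
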